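import Summits.BirchSwinnertonDyer.BirchSwinnertonDyer.Theorems.CongruentShaFreeCutLinkBStructure
import Summits.BirchSwinnertonDyer.BirchSwinnertonDyer.Theorems.MordellShaFreeCutThreeAdicLinks

/-! # Route `MordellShaFreeCut` (rung S2b) — crux `AnalyticRankOneOfRankOneFiniteShaThree`
(stmt-BirchSwinnertonDyer-19160): the two HALVES of Link B `ThreeAdicCharValueEqHeegnerLogSq` — the
half at non-torsion Heegner points is Gross–Zagier–Kolyvagin + Link A; the registered stub is
EQUIVALENT to its torsion half (the S2b twin of `CongruentShaFreeCutLinkBHalves`)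

Cell `bsd-cn100`, prover seat `bsd-cn100-s2-c3` g4 (service for the s2b hand). Supports, does not
close, stmt-BirchSwinnertonDyer-19160. HONEST FRAMING: theorems ABOUT the open Link B of the registered
skeleton `three-adic-links` (`MordellShaFreeCutThreeAdicLinks`, p424081); CONDITIONAL on the
hypotheses named (Link A `ThreeAdicControlOfRankOne` — a kernel theorem modulo Poitou–Tate, p432373 —,
Gross–Zagier, Gross–Zagier + Kolyvagin over `K`); nothing about BSD, crux B, the leaf
`rankOne_threeConverse_cubeSum` or Sylvester's problem is proved and Link B is not proved.

## What is proved

* **`threeAdicCharValue_of_not_isOfFinAddOrder`** — the EASY HALF: for `W/ℚ` elliptic, globally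
  minimal with `j = 0`, every datum `(K, N, ι, v, v̄, κ, γ)` of the links and every Heegner point
  `P ∈ W(K)` of level `N = N(W)` which is NOT torsion, `CharValueEqLogSqAt W 3 κ v̄ γ ι P` HOLDS,
  granted Link A, `analyticRankEK_eq_one_iff_heegner_nonTorsion`, `analyticRankEK_eq_one_iff_LDerivEK_ne_zero`
  and `mordellWeilRank_eq_one_of_LDerivEK_ne_zero` (P non-torsion ⟹ `ord L(W/K) = 1` ⟹ rank 1 ∧ Ш
  finite ⟹ Link A ⟹ `F(0) ≠ 0` ⟹ `u = F(0)/(log_ω P)²`). NO corank hypothesis.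
* **`linkB_iff_torsionHalf`** — hence the registered Link B is EQUIVALENT (granted the same facts) to
  its TORSION HALF «`j(W) = 0`, corank_{ℤ₃} Sel_{3^∞}(W/K) = 1 and some Heegner point of level `N` is
  torsion ⟹ `𝔛 = X_{v̄}^{∅}(W[3^∞]/K_∞)` is `Λ`-torsion with a characteristic generator vanishing at
  𝟙» — the contrapositive packaging of the `3`-adic `p`-converse step at the additive prime `3`.
[cite: GrossZagier1986, Thm. I.6.3 with V.§2 (y_K non-torsion ↔ L'(E/K,1) ≠ 0)]
[cite: CastellaGrossiLeeSkinner2022, §5.2 (proof of Thm. 5.2.1: shape of a BDP-type p-converse)] -/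

set_option linter.dupNamespace false

noncomputable section

open scoped Classical

namespace Summit.BirchSwinnertonDyer.BirchSwinnertonDyer.Theorems.MordellShaFreeCutLinkBHalves

open WeierstrassCurve NumberField IsDedekindDomain Field Literature.NumberTheory.EllipticCurves
  Literature.NumberTheory.EllipticCurves.Castella2018
open Summit.BirchSwinnertonDyer.BirchSwinnertonDyer.Theorems.MordellShaFreeCutThreeAdicLinks
  (ThreeAdicControlOfRankOne ThreeAdicCharValueEqHeegnerLogSq)
open Summit.BirchSwinnertonDyer.BirchSwinnertonDyer.Theorems.CongruentShaFreeCutLinkBStructure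
  (charValueEqLogSqAt_iff charValueEqLogSqAt_of_hasCharValuationAt_of_not_isOfFinAddOrder)

/-- **The easy half of Link B (S2b): at a NON-TORSION Heegner point, Link B's conclusion follows from
Link A and Gross–Zagier–Kolyvagin.** For `W/ℚ` elliptic, globally minimal with `j = 0`, a datum
`(K, N, ι, v, v̄, κ, γ)` as in the links and a Heegner point `P ∈ W(K)` of level `N = N(W)` of INFINITE
order: `CharValueEqLogSqAt W 3 κ v̄ γ ι P`. Proof as for S2: `hGZ` ⟹ `ord_{s=1} L(W/K, s) = 1`;
`mordellWeilRank_eq_one_of_analyticRankEK_eq_one` (`hGZ'`, `hKoly`) ⟹ `rank W(K) = 1`, `Ш(W/K)`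
finite; Link A (`hA`) ⟹ `F(0) ≠ 0`; `charValueEqLogSqAt_of_hasCharValuationAt_of_not_isOfFinAddOrder`.
No Selmer-corank hypothesis. CONDITIONAL on `hA`, `hGZ`, `hGZ'`, `hKoly`; credits nothing.
[cite: GrossZagier1986, Thm. I.6.3 with V.§2] [cite: CastellaGrossiLeeSkinner2022, §5.2 (shape)] -/
theorem threeAdicCharValue_of_not_isOfFinAddOrder
    (hA : ThreeAdicControlOfRankOne)
    (hGZ : ∀ (W : WeierstrassCurve ℚ) (N : ℕ) [NeZero N] (K : Type) [Field K] [NumberField K],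
      analyticRankEK_eq_one_iff_heegner_nonTorsion W N K)
    (hGZ' : ∀ (W : WeierstrassCurve ℚ) (N : ℕ) [NeZero N] (K : Type) [Field K] [NumberField K],
      analyticRankEK_eq_one_iff_LDerivEK_ne_zero W N K)
    (hKoly : ∀ (W : WeierstrassCurve ℚ) (K : Type) [Field K] [NumberField K],
      mordellWeilRank_eq_one_of_LDerivEK_ne_zero W K)
    (W : WeierstrassCurve ℚ) [W.IsElliptic] [W.IsGloballyMinimal] (hj : W.j = 0)
    (K : Type) [Field K] [NumberField K] (N : ℕ) [NeZero N]
    (hN : W.conductorNorm ℤ = N) (hK : IsImaginaryQuadratic K)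
    (hHN : SatisfiesHeegnerHypothesis N K) (hH3 : SatisfiesHeegnerHypothesis 3 K)
    (ι : K →+* ℚ_[3]) (v vbar : HeightOneSpectrum (𝓞 K))
    (hv : ∀ x : 𝓞 K, x ∈ v.asIdeal ↔ ‖ι (x : K)‖ < 1) (hvbar : ((3 : ℕ) : 𝓞 K) ∈ vbar.asIdeal)
    (hne : vbar ≠ v) (κ : ZpExtension K 3) (hκ : κ.IsAnticyclotomic)
    (γ : absoluteGaloisGroup K) [Fact (κ.IsTopGenerator γ)]
    (P : (W.baseChange K).toAffine.Point) (hP : IsHeegnerPoint N W K P) (hPnt : ¬ IsOfFinAddOrder P) :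
    AcPConverseLinks.CharValueEqLogSqAt W 3 κ vbar γ ι P := by
  haveI : NeZero (W.conductorNorm ℤ) := ⟨hN ▸ NeZero.ne N⟩
  have hr : analyticRankEK W K = 1 := (hGZ W N K hK hN hHN hP).mpr hPnt
  obtain ⟨hrk, hShaFin⟩ := mordellWeilRank_eq_one_of_analyticRankEK_eq_one (W := W) (N := N) (K := K)
    (hGZ' W N K) (hKoly W K) hK hN hHN hr
  haveI : Finite (W.baseChange K).sha := hShaFin
  have hshaK : Finite (AddCommGroup.primaryComponent (W.baseChange K).sha 3) := inferInstance
  exact charValueEqLogSqAt_of_hasCharValuationAt_of_not_isOfFinAddOrder ι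
    (hA W hj K N hN hK hHN hH3 ι v vbar hv hvbar hne κ hκ γ hrk hshaK) hPnt

/-- **Link B (S2b) ⟺ its torsion half** (granted Link A, Gross–Zagier and Gross–Zagier + Kolyvagin
over `K`): `ThreeAdicCharValueEqHeegnerLogSq` holds iff for every `W` (elliptic, globally minimal,
`j = 0`), every datum of the links with `corank_{ℤ₃} Sel_{3^∞}(W/K) = 1` and every Heegner point
`P ∈ W(K)` of level `N` which IS torsion, `𝔛` is `Λ`-torsion and `char_Λ 𝔛 = (F)` with `F(0) = 0`.
(`→`: `charValueEqLogSqAt_iff`; `←`: torsion half + `charValueEqLogSqAt_iff` at torsion `P`,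
`threeAdicCharValue_of_not_isOfFinAddOrder` at non-torsion `P`.) CONDITIONAL; credits nothing.
[cite: GrossZagier1986, Thm. I.6.3 with V.§2] [cite: CastellaGrossiLeeSkinner2022, §5.2 (shape)] -/
theorem linkB_iff_torsionHalf
    (hA : ThreeAdicControlOfRankOne)
    (hGZ : ∀ (W : WeierstrassCurve ℚ) (N : ℕ) [NeZero N] (K : Type) [Field K] [NumberField K],
      analyticRankEK_eq_one_iff_heegner_nonTorsion W N K)
    (hGZ' : ∀ (W : WeierstrassCurve ℚ) (N : ℕ) [NeZero N] (K : Type) [Field K] [NumberField K],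
      analyticRankEK_eq_one_iff_LDerivEK_ne_zero W N K)
    (hKoly : ∀ (W : WeierstrassCurve ℚ) (K : Type) [Field K] [NumberField K],
      mordellWeilRank_eq_one_of_LDerivEK_ne_zero W K) :
    ThreeAdicCharValueEqHeegnerLogSq ↔
      ∀ (W : WeierstrassCurve ℚ) [W.IsElliptic] [W.IsGloballyMinimal], W.j = 0 →
        ∀ (K : Type) [Field K] [NumberField K] (N : ℕ) [NeZero N],
        W.conductorNorm ℤ = N → IsImaginaryQuadratic K →
          SatisfiesHeegnerHypothesis N K → SatisfiesHeegnerHypothesis 3 K →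
        ∀ (ι : K →+* ℚ_[3]) (v vbar : HeightOneSpectrum (𝓞 K)),
          (∀ x : 𝓞 K, x ∈ v.asIdeal ↔ ‖ι (x : K)‖ < 1) →
          ((3 : ℕ) : 𝓞 K) ∈ vbar.asIdeal → vbar ≠ v →
        ∀ (κ : ZpExtension K 3), κ.IsAnticyclotomic →
        ∀ (γ : absoluteGaloisGroup K) [Fact (κ.IsTopGenerator γ)],
          (W.baseChange K).selmerCorank 3 = 1 →
        ∀ (P : (W.baseChange K).toAffine.Point), IsHeegnerPoint N W K P → IsOfFinAddOrder P →
          Module.IsTorsion (IwasawaAlgebra 3) (AcSelmer.XAc (W.baseChange K) 3 κ vbar ∅ γ) ∧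
            ∃ F : IwasawaAlgebra 3,
              AcSelmer.XAc.charIdeal (W.baseChange K) 3 κ vbar ∅ γ = Ideal.span {F} ∧
                PowerSeries.constantCoeff F = 0 := by
  constructor
  · intro hB W _ _ hj K _ _ N _ hN hK hHN hH3 ι v vbar hv hvbar hne κ hκ γ _ hSel P hP hPt
    obtain ⟨htors, F, hF, hiff⟩ := (charValueEqLogSqAt_iff W 3 κ vbar γ ι P).mp
      (hB W hj K N hN hK hHN hH3 ι v vbar hv hvbar hne κ hκ γ hSel P hP)
    exact ⟨htors, F, hF, hiff.mpr hPt⟩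
  · intro hH W _ _ hj K _ _ N _ hN hK hHN hH3 ι v vbar hv hvbar hne κ hκ γ _ hSel P hP
    by_cases hPt : IsOfFinAddOrder P
    · obtain ⟨htors, F, hF, hF0⟩ :=
        hH W hj K N hN hK hHN hH3 ι v vbar hv hvbar hne κ hκ γ hSel P hP hPt
      exact (charValueEqLogSqAt_iff W 3 κ vbar γ ι P).mpr ⟨htors, F, hF, ⟨fun _ ↦ hPt, fun _ ↦ hF0⟩⟩
    · exact threeAdicCharValue_of_not_isOfFinAddOrder hA hGZ hGZ' hKoly W hj K N hN hK hHN hH3 ι v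
        vbar hv hvbar hne κ hκ γ P hP hPt

end Summit.BirchSwinnertonDyer.BirchSwinnertonDyer.Theorems.MordellShaFreeCutLinkBHalves

end
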